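import Mathlib
import Summits.Ventures.HodgeRepro2.T5AmiceTransform

/-!
# T5AmiceInverse — every bounded power series is the Amice transform of a measure:
«W[[Γ_𝔭]] ≅ W[[T]]» as a bijection between bounded functionals on `C(ℤ_p, R)` and bounded power series

Cell pub-hodge-repro2, Tier 5 support (seat p7; route/T5-CHECK-G-p7.md §3 S5). T5AmiceTransform showed
`m ↦ f_m = Σ_n m(x choose n) Tⁿ` is injective on continuous functionals, with `‖coeff_n f_m‖ ≤ C‖1‖`.
Here the converse: a power series with BOUNDED coefficients `a_n` defines the bounded functional
`m_a(φ) := Σ_n a_n · (Δⁿφ)(0)` (the Mahler coefficients `(Δⁿφ)(0) → 0`, so the series converges in the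
ultrametric complete `R`; `‖m_a φ‖ ≤ C‖φ‖`), and `f_{m_a} = Σ a_n Tⁿ` because
`(Δʲ (x choose n))(0) = δ_{jn}` (Mathlib's `fwdDiff_mahlerSeries`). Together with
`T5AmiceTransform.map_eq_tsum_fwdDiff` (`m_{f_m} = m`, Mahler's theorem) this is the bijection
`amiceEquiv` between bounded `R`-linear functionals on `C(ℤ_p, R)` («`𝒪`-valued measures on `Γ_𝔭`»)
and power series with bounded coefficients — the module-level content of S5's «W[[Γ_𝔭]] ≅ W[[T]]»
(the ring structure / convolution is not modelled). Mathlib + own T5AmiceTransform.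
-/

namespace Summit.Ventures.HodgeRepro2.T5AmiceInverse

open PadicInt Filter Topology
open Summit.Ventures.HodgeRepro2.T5AmiceTransform

variable {p : ℕ} [hp : Fact p.Prime]
variable {R : Type*} [NormedCommRing R] [Algebra ℤ_[p] R] [IsBoundedSMul ℤ_[p] R]
  [IsUltrametricDist R] [CompleteSpace R]

omit [IsUltrametricDist R] [CompleteSpace R] in
/-- `mahlerTerm 0 n = 0`. -/
theorem mahlerTerm_zero (n : ℕ) : (mahlerTerm (0 : R) n : C(ℤ_[p], R)) = 0 := by
  ext x
  simp [mahlerTerm_apply]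

omit [IsUltrametricDist R] [CompleteSpace R] in
/-- The Mahler series with the single coefficient `1` in degree `n` is `mahlerTerm 1 n = (x choose n)`. -/
theorem mahlerSeries_single (n : ℕ) :
    (mahlerSeries (Pi.single n (1 : R)) : C(ℤ_[p], R)) = mahlerTerm (1 : R) n := by
  unfold mahlerSeries
  rw [tsum_eq_single n]
  · simp
  · intro j hj
    simp [hj, mahlerTerm_zero]

omit [IsUltrametricDist R] [CompleteSpace R] in
/-- `Pi.single n 1 → 0` (eventually zero). -/
theorem tendsto_single (n : ℕ) : Tendsto (Pi.single n (1 : R) : ℕ → R) atTop (𝓝 0) := by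
  refine tendsto_const_nhds.congr' ?_
  filter_upwards [Filter.eventually_gt_atTop n] with j hj
  simp [hj.ne']

/-- `(Δʲ (x choose n))(0) = δ_{jn}`: the Mahler coefficients of `(x choose n)` (Mathlib's
`fwdDiff_mahlerSeries` on the single-term series). -/
theorem fwdDiff_iter_mahlerTerm_one (j n : ℕ) :
    (fwdDiff (1 : ℤ_[p]))^[j] (⇑(mahlerTerm (1 : R) n : C(ℤ_[p], R))) 0 =
      if j = n then (1 : R) else 0 := by
  rw [← mahlerSeries_single, fwdDiff_mahlerSeries (tendsto_single n) j, Pi.single_apply]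

section ofCoeffs

variable (a : ℕ → R)

omit [CompleteSpace R] in
/-- The terms `a_n · (Δⁿφ)(0)` of `m_a(φ)` tend to `0` when `a` is bounded. -/
theorem tendsto_coeff_mul_fwdDiff {C : ℝ} (ha : ∀ n, ‖a n‖ ≤ C) (φ : C(ℤ_[p], R)) :
    Tendsto (fun n => a n * (fwdDiff (1 : ℤ_[p]))^[n] (⇑φ) 0) atTop (𝓝 0) := by
  have h0 : Tendsto (fun n => (fwdDiff (1 : ℤ_[p]))^[n] (⇑φ) 0) atTop (𝓝 0) := fwdDiff_tendsto_zero φ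
  rw [tendsto_zero_iff_norm_tendsto_zero] at h0 ⊢
  have hC : 0 ≤ C := (norm_nonneg _).trans (ha 0)
  refine squeeze_zero (fun n => norm_nonneg _) (fun n => ?_) (by simpa using h0.const_mul C)
  calc ‖a n * (fwdDiff (1 : ℤ_[p]))^[n] (⇑φ) 0‖ ≤ ‖a n‖ * ‖(fwdDiff (1 : ℤ_[p]))^[n] (⇑φ) 0‖ :=
        norm_mul_le _ _
    _ ≤ C * ‖(fwdDiff (1 : ℤ_[p]))^[n] (⇑φ) 0‖ := by gcongr; exact ha n

/-- The series `Σ_n a_n (Δⁿφ)(0)` is summable (ultrametric: terms → 0 suffices). -/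
theorem summable_coeff_mul_fwdDiff {C : ℝ} (ha : ∀ n, ‖a n‖ ≤ C) (φ : C(ℤ_[p], R)) :
    Summable (fun n => a n * (fwdDiff (1 : ℤ_[p]))^[n] (⇑φ) 0) :=
  NonarchimedeanAddGroup.summable_of_tendsto_cofinite_zero
    (by simpa only [Nat.cofinite_eq_atTop] using tendsto_coeff_mul_fwdDiff a ha φ)

variable (p) in
/-- THE MEASURE OF A BOUNDED POWER SERIES: `m_a(φ) := Σ_n a_n · (Δⁿφ)(0)`, an `R`-linear functional on
`C(ℤ_p, R)` (its Amice transform is `Σ a_n Tⁿ`, `amice_ofCoeffs`). -/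
noncomputable def ofCoeffs {C : ℝ} (ha : ∀ n, ‖a n‖ ≤ C) : C(ℤ_[p], R) →ₗ[R] R where
  toFun φ := ∑' n, a n * (fwdDiff (1 : ℤ_[p]))^[n] (⇑φ) 0
  map_add' φ ψ := by
    rw [← (summable_coeff_mul_fwdDiff a ha φ).tsum_add (summable_coeff_mul_fwdDiff a ha ψ)]
    congr 1
    funext n
    rw [ContinuousMap.coe_add, fwdDiff_iter_add, Pi.add_apply, mul_add]
  map_smul' c φ := by
    simp only [RingHom.id_apply]
    rw [smul_eq_mul, ← (summable_coeff_mul_fwdDiff a ha φ).tsum_mul_left c]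
    congr 1
    funext n
    rw [ContinuousMap.coe_smul, fwdDiff_iter_const_smul, Pi.smul_apply, smul_eq_mul, mul_left_comm]

/-- The defining formula of `ofCoeffs`. -/
theorem ofCoeffs_apply {C : ℝ} (ha : ∀ n, ‖a n‖ ≤ C) (φ : C(ℤ_[p], R)) :
    ofCoeffs p a ha φ = ∑' n, a n * (fwdDiff (1 : ℤ_[p]))^[n] (⇑φ) 0 := rfl

/-- `m_a` is bounded: `‖m_a φ‖ ≤ C ‖φ‖` (ultrametric `‖Σ‖ ≤ sup`, and `‖(Δⁿφ)(0)‖ ≤ ‖φ‖`). -/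
theorem norm_ofCoeffs_le {C : ℝ} (ha : ∀ n, ‖a n‖ ≤ C) (φ : C(ℤ_[p], R)) :
    ‖ofCoeffs p a ha φ‖ ≤ C * ‖φ‖ := by
  have hC : 0 ≤ C := (norm_nonneg _).trans (ha 0)
  rw [ofCoeffs_apply]
  refine IsUltrametricDist.norm_tsum_le_of_forall_le_of_nonneg (by positivity) fun n => ?_
  calc ‖a n * (fwdDiff (1 : ℤ_[p]))^[n] (⇑φ) 0‖ ≤ ‖a n‖ * ‖(fwdDiff (1 : ℤ_[p]))^[n] (⇑φ) 0‖ :=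
        norm_mul_le _ _
    _ ≤ C * ‖φ‖ := by
        gcongr
        · exact ha n
        · exact IsUltrametricDist.norm_fwdDiff_iter_apply_le 1 φ 0 n

/-- `m_a` is continuous. -/
theorem continuous_ofCoeffs {C : ℝ} (ha : ∀ n, ‖a n‖ ≤ C) : Continuous (ofCoeffs p a ha) :=
  continuous_of_bound _ C (norm_ofCoeffs_le a ha)

/-- The moments of `m_a` are the `a_n`: `m_a(x choose n) = a_n`. -/
theorem ofCoeffs_mahlerTerm_one {C : ℝ} (ha : ∀ n, ‖a n‖ ≤ C) (n : ℕ) :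
    ofCoeffs p a ha (mahlerTerm (1 : R) n) = a n := by
  rw [ofCoeffs_apply, tsum_eq_single n]
  · rw [fwdDiff_iter_mahlerTerm_one, if_pos rfl, mul_one]
  · intro j hj
    rw [fwdDiff_iter_mahlerTerm_one, if_neg hj, mul_zero]

/-- THE AMICE TRANSFORM IS ONTO the bounded power series: `f_{m_a} = Σ_n a_n Tⁿ`. -/
theorem amice_ofCoeffs {C : ℝ} (ha : ∀ n, ‖a n‖ ≤ C) :
    amice (ofCoeffs p a ha) = PowerSeries.mk a := by
  ext n
  rw [coeff_amice, PowerSeries.coeff_mk, ofCoeffs_mahlerTerm_one]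

end ofCoeffs

/-- The measure of the transform of a continuous functional `m` is `m` (Mahler's theorem,
`T5AmiceTransform.map_eq_tsum_fwdDiff`). -/
theorem ofCoeffs_amice (m : C(ℤ_[p], R) →ₗ[R] R) (hm : Continuous m) {C : ℝ}
    (hC : ∀ n, ‖PowerSeries.coeff n (amice m)‖ ≤ C) :
    ofCoeffs p (fun n => PowerSeries.coeff n (amice m)) hC = m := by
  ext φ
  rw [ofCoeffs_apply, map_eq_tsum_fwdDiff m hm φ]
  congr 1
  funext n
  rw [coeff_amice, mul_comm]

/-- «W[[Γ_𝔭]] ≅ W[[T]]», module level: bounded `R`-linear functionals on `C(ℤ_p, R)` correspond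
bijectively, via the Amice transform, to power series with bounded coefficients. -/
noncomputable def amiceEquiv :
    {m : C(ℤ_[p], R) →ₗ[R] R // ∃ C : ℝ, ∀ φ, ‖m φ‖ ≤ C * ‖φ‖} ≃
      {f : PowerSeries R // ∃ C : ℝ, ∀ n, ‖PowerSeries.coeff n f‖ ≤ C} where
  toFun m := ⟨amice m.1, Classical.choose m.2 * ‖(1 : R)‖,
    norm_coeff_amice_le m.1 _ (Classical.choose_spec m.2)⟩
  invFun f := ⟨ofCoeffs p (fun n => PowerSeries.coeff n f.1) (Classical.choose_spec f.2),
    Classical.choose f.2, norm_ofCoeffs_le _ _⟩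
  left_inv m := by
    apply Subtype.ext
    dsimp only
    exact ofCoeffs_amice m.1 (continuous_of_bound m.1 _ (Classical.choose_spec m.2)) _
  right_inv f := by
    apply Subtype.ext
    dsimp only
    rw [amice_ofCoeffs]
    exact PowerSeries.ext fun n => by rw [PowerSeries.coeff_mk]

/-- `amiceEquiv m = f_m`. -/
theorem amiceEquiv_apply (m : {m : C(ℤ_[p], R) →ₗ[R] R // ∃ C : ℝ, ∀ φ, ‖m φ‖ ≤ C * ‖φ‖}) :
    (amiceEquiv m : PowerSeries R) = amice m.1 := rfl

/-- Every power series with bounded coefficients is the Amice transform of a bounded functional. -/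
theorem exists_amice_eq (f : PowerSeries R) {C : ℝ} (hf : ∀ n, ‖PowerSeries.coeff n f‖ ≤ C) :
    ∃ m : C(ℤ_[p], R) →ₗ[R] R, (∀ φ, ‖m φ‖ ≤ C * ‖φ‖) ∧ amice m = f :=
  ⟨ofCoeffs p (fun n => PowerSeries.coeff n f) hf, norm_ofCoeffs_le _ hf, by
    rw [amice_ofCoeffs]
    exact PowerSeries.ext fun n => by rw [PowerSeries.coeff_mk]⟩

end Summit.Ventures.HodgeRepro2.T5AmiceInverse
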